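import Summits.CriticalPhenomena.SAWScalingLimit.Theorems.SAWDevelopingMapObservableToSLETypeLadderCarvedReductionSqueezeKernel
import Summits.CriticalPhenomena.SAWScalingLimit.Theorems.SAWDevelopingMapObservableToSLETypeLadderCarvedReductionSqueezeCollar
import Literature.Probability.RandomPlanarGeometry.HullSubdomainPullback
import Literature.Probability.RandomPlanarGeometry.ConformalMapRiemannProofs
import Literature.Probability.RandomPlanarGeometry.CaratheodoryHalfPlaneProofs
import Literature.Probability.RandomPlanarGeometry.ConformalMapCaratheodoryProofs
import Literature.Probability.RandomPlanarGeometry.JordanDomainProofs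
import HarnessLib

/-!
# The two-sided DERIVATIVE SQUEEZE in a fixed conformal frame (piece (G6″) of stub 5a4′)

Piece of stub 5a4′ `stub_carvedReduction_squeeze` (`TwoPieceAdmRestrictionLimit → MovingCarvingSqueeze`)
of the line `bridge-gate-renewal` (r8) of the crux `SAWDefectDecoherence.ObservableToSLER`
(stmt-CriticalPhenomena-14005; = twin T2b′ of stmt-CriticalPhenomena-10472), item (G6) of its
audit: ARL″ is applied to the pairs `(E_n, M')` — FIXED outer Jordan approximants `E_n ↓` (hull
subdomains of the common two-piece flat super-domain `E`, chordal uniformizer `φ`) of the moving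
carved domains and a FIXED inner approximant `M'` — and yields the ratio limit `d_n^{5/8}`, `d_n`
the restriction derivative of the hull of `M'` pulled back by a uniformizer OF `E_n`.  This file
is the analysis turning the geometric squeeze into `d_n ≥ 1 − ε`:

* `restrictionDeriv_quotient_ge` — in half-plane coordinates: for a nonempty `*`-hull `A` (the
  limit carving's hull) and increasing `*`-hulls `A_n ⊆ A` satisfying the COMPONENT kernel
  hypothesis, for every `ε > 0` there are `δ₀ > 0` and `n₀` such that for `n ≥ n₀` and every
  `*`-hull `H` with `A ⊆ H ⊆ thickHull A δ₀ ∪ {im ≤ θ, r' ≤ |z| ≤ R'}` (a thin thickening plus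
  a thin boundary collar) the QUOTIENT hull `cl Φ_{A_n}((H ∖ A_n) ∩ ℍ)` has restriction
  derivative `≥ 1 − ε` (outer continuity with collars
  `TypeLadder.stub_carvedReduction_collarDeriv`, twin piece p128980; kernel continuity in
  component form `TypeLadder.stub_carvedReduction_kernelComponent`, twin piece p128499; and the
  chain rule `HasRestrictionDeriv.eq_mul_quotientHull`);
* `pullbackHull_trans_restrHull` — for hull subdomains `E_n`, `M'` of `E` with `M' ⊆ E_n` and a
  restriction map `Φ'` of `A_n = φ.pullbackHull E_n`, the hull of `M'` pulled back by the
  uniformizer `φ ∘ Φ'⁻¹` of `E_n` (`IsChordalUniformizing.pullback`) IS that quotient hull;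
  `isHullSubdomain_of_subset` — `M'` is a hull subdomain of `E_n`;
* `stub_carvedReduction_derivFrame` — the registered packaging in domain language: eventually in
  `n`, for every hull subdomain `M'` of `E` inside `E_n` whose hull lies between `A` and
  `thickHull A δ₀ ∪ (collar)`, the data `(E_n, M', φ ∘ Φ'⁻¹)` are ARL″-ready (chordal uniformizer, hull
  subdomain) and EVERY restriction datum `(Ψ, d)` of the pulled-back hull has `1 − ε ≤ d`.

Sources: G. F. Lawler, O. Schramm, W. Werner, J. Amer. Math. Soc. 16 (2003) §2 (2.4), p. 8
(semigroups), proof of Lemma 3.5 (p. 12); Ch. Pommerenke, Boundary Behaviour of Conformal Maps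
(1992), Thm. 1.8.
-/

noncomputable section

open Set Filter Topology Metric Bornology Function
open UpperHalfPlane (upperHalfPlaneSet isOpen_upperHalfPlaneSet)
open Literature.Probability.RandomPlanarGeometry

namespace Summit.CriticalPhenomena.SAWScalingLimit.Theorems.ObservableToSLER.Squeeze

open Summit.CriticalPhenomena.SAWScalingLimit.Theorems.ObservableToSLE.TypeLadder
  (stub_carvedReduction_kernelComponent stub_carvedReduction_collarDeriv)

/-! ### Half-plane coordinates: the quotient hulls of thin outer hulls over a kernel exhaustion -/

/-- **The derivative squeeze in half-plane coordinates.**  Let `A` be a nonempty `*`-hull and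
`A_n ↑` `*`-hulls inside `A` with the COMPONENT kernel property.  For every `ε > 0`, inner radius
`r' > 0` and outer radius `R'` there are `δ₀ > 0`, `θ > 0` and `n₀` such that for all `n ≥ n₀`,
every `*`-hull `H` with `A ⊆ H ⊆ thickHull A δ₀ ∪ {z | im z ≤ θ ∧ r' ≤ ‖z‖ ≤ R'}`, every
restriction map `Φ'` of `A_n` with `Φ'⁻¹ → 0` at `0` and `→ ∞` at `∞`, and every restriction datum
`(ΨQ, dQ)` of the quotient hull `cl Φ'((H ∖ A_n) ∩ ℍ)`: `1 − ε ≤ dQ`.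
[cite: LawlerSchrammWerner2003Restriction, §2 (2.4) p. 7, p. 8 (Semigroups), proof of Lemma 3.5 (p. 12)] -/
theorem restrictionDeriv_quotient_ge {A : Set ℂ} {An : ℕ → Set ℂ} (hA : IsStarHull A)
    (hne : A.Nonempty) (hAn : ∀ n, IsStarHull (An n)) (hmono : Monotone An) (hsub : ∀ n, An n ⊆ A)
    (hker : ∀ W : Set ℂ, IsOpen W → IsPreconnected W → W ⊆ ⋂ n, upperHalfPlaneSet \ An n →
      (W ∩ (upperHalfPlaneSet \ A)).Nonempty → W ⊆ upperHalfPlaneSet \ A)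
    {ε r' : ℝ} (hε : 0 < ε) (hr' : 0 < r') (R' : ℝ) :
    ∃ δ₀ > (0 : ℝ), ∃ θ > (0 : ℝ), ∃ n₀ : ℕ, ∀ n, n₀ ≤ n → ∀ (H : Set ℂ), IsStarHull H → A ⊆ H →
      H ⊆ thickHull A δ₀ ∪ {z : ℂ | z.im ≤ θ ∧ r' ≤ ‖z‖ ∧ ‖z‖ ≤ R'} →
      ∀ (Φ' : ConformalEquiv (upperHalfPlaneSet \ An n) upperHalfPlaneSet),
        IsRestrictionMap (An n) Φ' → Tendsto Φ'.symm (𝓝[upperHalfPlaneSet] 0) (𝓝 0) →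
        Tendsto Φ'.symm (cocompact ℂ ⊓ 𝓟 upperHalfPlaneSet) (cocompact ℂ) →
        ∀ (ΨQ : ConformalEquiv (upperHalfPlaneSet \ quotientHull H (An n) Φ') upperHalfPlaneSet)
          (dQ : ℝ), IsRestrictionMap (quotientHull H (An n) Φ') ΨQ →
          HasRestrictionDeriv (quotientHull H (An n) Φ') ΨQ dQ → 1 - ε ≤ dQ := by
  classical
  -- restriction data of `A` and of the `A_n`
  obtain ⟨ΦA, hΦA, -⟩ := IsStarHull.existsUnique_isRestrictionMap_holds hA
  obtain ⟨dA, hdA0, -, hdA⟩ := IsStarHull.exists_hasRestrictionDeriv_holds hA hΦA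
  choose Φn hΦn _huniq using fun n => IsStarHull.existsUnique_isRestrictionMap_holds (hAn n)
  choose dn hdn0 _hdn1 hdn using fun n => IsStarHull.exists_hasRestrictionDeriv_holds (hAn n) (hΦn n)
  -- the auxiliary level `ε₁ ∈ (0, 1)`
  set ε₁ : ℝ := min (ε / 2) (1 / 2) with hε₁
  have hε₁0 : 0 < ε₁ := lt_min (half_pos hε) (by norm_num)
  have hε₁1 : ε₁ < 1 := (min_le_right _ _).trans_lt (by norm_num)
  have hε₁ε : 2 * ε₁ ≤ ε := by linarith [min_le_left (ε / 2) (1 / 2)]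
  -- outer continuity at `A`, with collars
  obtain ⟨δ₀, hδ₀, θ, hθ, hout⟩ := stub_carvedReduction_collarDeriv A ΦA dA ε₁ r' R' hA hne hΦA hdA hε₁0 hr'
  -- kernel continuity (component form) along `A_n`
  have hlim : Tendsto dn atTop (𝓝 dA) :=
    stub_carvedReduction_kernelComponent A An ΦA Φn dA dn hA hAn hmono hsub hker hΦA hdA hΦn hdn
  have hlt : dA < dA / (1 - ε₁) := by
    rw [lt_div_iff₀ (by linarith)]
    nlinarith
  obtain ⟨n₀, hn₀⟩ := (hlim.eventually (gt_mem_nhds hlt)).exists_forall_of_atTop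
  refine ⟨δ₀, hδ₀, θ, hθ, n₀, fun n hn H hH hAH hHt Φ' hΦ' h0 hinf ΨQ dQ hΨQ hdQ => ?_⟩
  -- restriction data of `H`; the derivative of `A_n` along `Φ'`
  obtain ⟨ΨH, hΨH, -⟩ := IsStarHull.existsUnique_isRestrictionMap_holds hH
  obtain ⟨eH, -, -, heH⟩ := IsStarHull.exists_hasRestrictionDeriv_holds hH hΨH
  have hdn' : HasRestrictionDeriv (An n) Φ' (dn n) := (hdn n).of_isRestrictionMap (hAn n) (hΦn n) hΦ'
  -- chain rule `eH = dQ · dn n`, lower bound `(1 - ε₁) dA ≤ eH`, and `dn n < dA / (1 - ε₁)`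
  have hchain : eH = dQ * dn n :=
    heH.eq_mul_quotientHull hH (hAn n) ((hsub n).trans hAH) hΦ' h0 hinf hΨH hdn' hΨQ hdQ
  have hlow : (1 - ε₁) * dA ≤ eH := hout H ΨH eH hH hAH hHt hΨH heH
  have hdnlt : dn n < dA / (1 - ε₁) := hn₀ n hn
  have hdnlt' : dn n * (1 - ε₁) < dA := by rwa [lt_div_iff₀ (by linarith)] at hdnlt
  have hdnpos : 0 < dn n := hdn0 n
  -- `dQ · dn ≥ (1 - ε₁) dA > (1 - ε₁)² dn`, so `dQ > (1 - ε₁)² ≥ 1 - 2 ε₁ ≥ 1 - ε`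
  have h1 : (1 - ε₁) * ((1 - ε₁) * dn n) ≤ dQ * dn n := by
    have : (1 - ε₁) * ((1 - ε₁) * dn n) ≤ (1 - ε₁) * dA :=
      mul_le_mul_of_nonneg_left (by linarith) (by linarith)
    linarith
  have h2 : (1 - ε₁) * (1 - ε₁) ≤ dQ := by
    have h3 : ((1 - ε₁) * (1 - ε₁)) * dn n ≤ dQ * dn n := by linarith
    exact le_of_mul_le_mul_right h3 hdnpos
  nlinarith

/-! ### Domain language: the uniformizer `φ ∘ Φ'⁻¹` of an outer approximant -/

section Frame

variable {E En M : DobrushinDomain} {φ : ConformalEquiv upperHalfPlaneSet E.carrier}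

/-- **The hull of `M` pulled back by the uniformizer `φ ∘ Φ'⁻¹` of `E_n` is the quotient hull**
`cl Φ'((φ.pullbackHull M ∖ φ.pullbackHull E_n) ∩ ℍ)` (`Φ'` any conformal map of
`ℍ ∖ φ.pullbackHull E_n` onto `ℍ`). -/
theorem pullbackHull_trans_restrHull (hEn : En.carrier ⊆ E.carrier)
    (Φ' : ConformalEquiv (upperHalfPlaneSet \ φ.pullbackHull En) upperHalfPlaneSet) :
    (Φ'.symm.trans (φ.restrHull En hEn)).pullbackHull M =
      quotientHull (φ.pullbackHull M) (φ.pullbackHull En) Φ' := by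
  set ψ := Φ'.symm.trans (φ.restrHull En hEn) with hψ
  have hψapply : ∀ z, ψ z = φ (Φ'.symm z) := fun z => rfl
  have hmemM : ∀ {w : ℂ}, w ∈ upperHalfPlaneSet →
      (w ∈ φ.pullbackHull M ↔ φ w ∉ M.carrier) := by
    intro w hw
    have key : w ∈ φ.pullbackHull M ∩ upperHalfPlaneSet ↔ w ∈ upperHalfPlaneSet \ φ.pullbackDomain M := by
      rw [ConformalEquiv.pullbackHull_inter]
    constructor
    · intro h hM
      exact (key.1 ⟨h, hw⟩).2 ⟨hw, hM⟩
    · intro h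
      exact (key.2 ⟨hw, fun hD => h hD.2⟩).1
  unfold ConformalEquiv.pullbackHull quotientHull
  congr 1
  ext z
  constructor
  · rintro ⟨hz, hzD⟩
    have hψz : ψ z ∉ M.carrier := fun h => hzD ⟨hz, h⟩
    have hw : Φ'.symm z ∈ upperHalfPlaneSet \ φ.pullbackHull En := Φ'.symm_mapsTo hz
    refine ⟨Φ'.symm z, ⟨⟨(hmemM hw.1).2 ?_, hw.2⟩, hw.1⟩, Φ'.apply_symm_apply hz⟩
    rwa [hψapply] at hψz
  · rintro ⟨w, ⟨⟨hwM, hwEn⟩, hwH⟩, rfl⟩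
    have hz : Φ' w ∈ upperHalfPlaneSet := Φ'.mapsTo ⟨hwH, hwEn⟩
    refine ⟨hz, fun hD => ?_⟩
    have h1 : ψ (Φ' w) = φ w := by rw [hψapply, Φ'.symm_apply_apply ⟨hwH, hwEn⟩]
    exact (hmemM hwH).1 hwM (h1 ▸ hD.2)

/-- A hull subdomain `M` of `E` lying inside a hull subdomain `E_n` of `E` is a hull subdomain
of `E_n`. -/
theorem isHullSubdomain_of_subset (hEn : E.IsHullSubdomain En) (hM : E.IsHullSubdomain M)
    (hMEn : M.carrier ⊆ En.carrier) : En.IsHullSubdomain M := by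
  refine ⟨hMEn, hM.pt_zero_eq.trans hEn.pt_zero_eq.symm, hM.pt_one_eq.trans hEn.pt_one_eq.symm,
    ?_, ?_⟩
  · rw [hEn.pt_zero_eq]
    exact fun h => hM.pt_zero_notMem (closure_mono (sdiff_subset_sdiff_left hEn.carrier_subset) h)
  · rw [hEn.pt_one_eq]
    exact fun h => hM.pt_one_notMem (closure_mono (sdiff_subset_sdiff_left hEn.carrier_subset) h)

end Frame

/-- **Registered sub-goal `stub_carvedReduction_derivFrame`** (crux item stmt-CriticalPhenomena-14005,
stub 5a4′ `stub_carvedReduction_squeeze`, piece (G6″) THE DERIVATIVE SQUEEZE IN A FIXED FRAME):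
let `E` be a Dobrushin domain with chordal uniformizer `φ`, `A` a nonempty `*`-hull (the hull of
the limit carving), and `E_n` hull subdomains of `E` (the outer approximants) whose pulled-back
hulls `A_n` increase inside `A` with the COMPONENT kernel property.  Then for every `ε > 0`,
`r' > 0` and `R'` there are `δ₀ > 0`, `θ > 0` and `n₀` such that for every `n ≥ n₀`, every hull
subdomain `M'` of `E` inside `E_n` with
`A ⊆ φ.pullbackHull M' ⊆ thickHull A δ₀ ∪ {z | im z ≤ θ ∧ r' ≤ ‖z‖ ≤ R'}` (thin thickening plus
thin boundary collar off `0` and `∞`), and every restriction map `Φ'` of `A_n` with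
`Φ'⁻¹ → 0` at `0` and `→ ∞` at `∞`: `φ ∘ Φ'⁻¹` is a chordal uniformizer of `E_n`, `M'` is a hull
subdomain of `E_n`, and every restriction datum `(Ψ, d)` of the hull of `M'` pulled back by
`φ ∘ Φ'⁻¹` — the `d` of ARL″ for the pair `(E_n, M')` — satisfies `1 − ε ≤ d`. -/
theorem stub_carvedReduction_derivFrame :
    ∀ (E : DobrushinDomain) (φ : ConformalEquiv upperHalfPlaneSet E.carrier) (A : Set ℂ)
      (En : ℕ → DobrushinDomain) (hEn : ∀ n, E.IsHullSubdomain (En n)),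
      E.IsChordalUniformizing φ → IsStarHull A → A.Nonempty →
      Monotone (fun n => φ.pullbackHull (En n)) → (∀ n, φ.pullbackHull (En n) ⊆ A) →
      (∀ W : Set ℂ, IsOpen W → IsPreconnected W →
        W ⊆ ⋂ n, upperHalfPlaneSet \ φ.pullbackHull (En n) →
        (W ∩ (upperHalfPlaneSet \ A)).Nonempty → W ⊆ upperHalfPlaneSet \ A) →
      ∀ (ε r' R' : ℝ), 0 < ε → 0 < r' → ∃ δ₀ > (0 : ℝ), ∃ θ > (0 : ℝ), ∃ n₀ : ℕ, ∀ n, n₀ ≤ n →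
        ∀ (M' : DobrushinDomain), E.IsHullSubdomain M' → M'.carrier ⊆ (En n).carrier →
          A ⊆ φ.pullbackHull M' →
          φ.pullbackHull M' ⊆ thickHull A δ₀ ∪ {z : ℂ | z.im ≤ θ ∧ r' ≤ ‖z‖ ∧ ‖z‖ ≤ R'} →
          ∀ (Φ' : ConformalEquiv (upperHalfPlaneSet \ φ.pullbackHull (En n)) upperHalfPlaneSet),
            IsRestrictionMap (φ.pullbackHull (En n)) Φ' →
            Tendsto Φ'.symm (𝓝[upperHalfPlaneSet] 0) (𝓝 0) →
            Tendsto Φ'.symm (cocompact ℂ ⊓ 𝓟 upperHalfPlaneSet) (cocompact ℂ) →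
            (En n).IsChordalUniformizing (Φ'.symm.trans (φ.restrHull (En n) (hEn n).carrier_subset)) ∧
            (En n).IsHullSubdomain M' ∧
            ∀ (Ψ : ConformalEquiv (upperHalfPlaneSet \
                (Φ'.symm.trans (φ.restrHull (En n) (hEn n).carrier_subset)).pullbackHull M')
                upperHalfPlaneSet) (d : ℝ),
              IsRestrictionMap ((Φ'.symm.trans (φ.restrHull (En n) (hEn n).carrier_subset)).pullbackHull M') Ψ →
              HasRestrictionDeriv
                ((Φ'.symm.trans (φ.restrHull (En n) (hEn n).carrier_subset)).pullbackHull M') Ψ d →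
              1 - ε ≤ d := by
  intro E φ A En hEn hφ hA hne hmono hsub hker ε r' R' hε hr'
  have hsc : ∀ D₀ : JordanDomain, D₀.isSimplyConnected := JordanDomain.isSimplyConnected_holds
  have hAn : ∀ n, IsStarHull (φ.pullbackHull (En n)) := fun n =>
    IsStarHull.pullbackHull hsc hφ (hEn n)
  obtain ⟨δ₀, hδ₀, θ, hθ, n₀, hmain⟩ :=
    restrictionDeriv_quotient_ge (An := fun n => φ.pullbackHull (En n)) hA hne hAn hmono hsub hker hε
      hr' R'
  refine ⟨δ₀, hδ₀, θ, hθ, n₀, fun n hn M' hM' hM'En hAH hHt Φ' hΦ' h0 hinf => ⟨?_, ?_, ?_⟩⟩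
  · exact MarkedDomain.IsChordalUniformizing.pullback hsc exists_conformalEquiv_ball_holds
      JordanDomain.exists_continuousOn_extension_holds hφ (hEn n) hΦ'
  · exact isHullSubdomain_of_subset (hEn n) hM' hM'En
  · -- the pulled-back hull is the quotient hull, a `*`-hull containing `A ⊆ H = φ.pullbackHull M'`
    have hH : IsStarHull (φ.pullbackHull M') := IsStarHull.pullbackHull hsc hφ hM'
    have heq := pullbackHull_trans_restrHull (M := M') (hEn n).carrier_subset Φ'
    have key : ∀ (S : Set ℂ), S = quotientHull (φ.pullbackHull M') (φ.pullbackHull (En n)) Φ' →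
        ∀ (Ψ : ConformalEquiv (upperHalfPlaneSet \ S) upperHalfPlaneSet) (d : ℝ),
          IsRestrictionMap S Ψ → HasRestrictionDeriv S Ψ d → 1 - ε ≤ d := by
      intro S hS
      subst hS
      intro Ψ d hΨ hd
      exact hmain n hn (φ.pullbackHull M') hH hAH hHt Φ' hΦ' h0 hinf Ψ d hΨ hd
    exact key _ heq

end Summit.CriticalPhenomena.SAWScalingLimit.Theorems.ObservableToSLER.Squeeze

end
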